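import Summits.QuantumAdvantage.QuantumAdvantage.Theorems.CubicForrelationNearExactIsExactTwelveLevelFiveBothDeadAt2932
import Summits.QuantumAdvantage.QuantumAdvantage.Theorems.CubicForrelationNearExactIsExactTwelveLevelSixBothAt2932

/-!
# Crux `CubicForrelation.NearExactIsExact` (stmt-QuantumAdvantage-14043) — n = 12 AT `Φ = 29/32`: the STRUCTURE OF THE PARTNER of a
  level-5 (configuration (c)) side — the residual mixed configuration "L5(c) × L6(Z₅₁₂, C)"

Certificate seat `b2b-cforr-cert` (gen 23).  HONEST FRAMING: a kernel-checked finite-slice structure theorem (standard axioms) about cubic Boolean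
pairs on 12 bits; it does NOT decide whether such pairs exist (whether `29/32` is a value at `n = 12` stays OPEN).  NOT summit progress.
Paper: HOME/b2b-cforr-cert-g23/PROOF-N12-928-CC.md §5.

`cp_partner_structure`: cubic `f, g`, `W_g = 32u'` with some `u'` odd, `29/32 ≤ Φ(f,g) < 1`, and `W_f = 64u''` (the partner is at level
`≥ 6` by `tw23_levelFive_partner_levelSix`).  Let `e'' = u'' − (−1)^g` and `Z = {u'' even}`.  Then, with `Ω = Ô/128 ∈ {0, ±4}`
(`Ô(y) = Σ_{x∈A} e(x)(−1)^{x·y} ∈ {0, ±512}`, `bd_Ohat`; `#{Ω ≠ 0} = 16`):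
* `Σ e''² = 768` (duality `ê = −128e''` and `Σ ê² = 4096·3072`);
* `#Z = 512` and `Z` is a 9-flat (`ŝ/128 = −(e'' + Ω)` is an odd integer on `Z`, `Σ (ŝ/128)² = 512`, and `Z ≠ ∅` is the support of a cubic:
  `stub_walshTower`, `bb_rmWeight_holds`, `mw_flat_of_minweight`; `Z = ∅` would make `f` bent, `tw_bent_end`);
* `(e'' + Ω)² = 1` on `Z` and `e'' = −Ω` off `Z` (and `ŝ = −128(e'' + Ω)` for the transform `ŝ` of `e·1_P`): so `e'' = ∓1` on `Z ∖ C`, `e'' = −Ω = ∓4` on `C ∖ Z`, `e'' ∈ {±3, ±5}` on `Z ∩ C`, `0` elsewhere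
  (`C = {Ω ≠ 0}`, 16 points).

References: MacWilliams–Sloane (1977) Ch. 13–15; O. Rothaus (1976); R. O'Donnell (2014) §1.4.  Axioms: the standard three.
-/

set_option linter.dupNamespace false -- D-0017: single-problem summit ⇒ `QuantumAdvantage.QuantumAdvantage` by design

noncomputable section

namespace Summit.QuantumAdvantage.QuantumAdvantage.Theorems.CubicForrelation.NearExactIsExact

open Finset
open Literature.Computability.QuantumComplexity
open Literature.Computability.QuantumComplexity.BuzetChailloux (bxor zeroVec bxor_bxor_cancel_left bxor_zeroVec zeroVec_bxor bxor_comm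
  bxor_self)
open Literature.Computability.QuantumComplexity.DerivativeWalsh (W)
open Literature.Computability.QuantumComplexity.BuzetChailloux (signOf_sq)
open Literature.Computability.QuantumComplexity.DerivativeWalsh (sum_W_sq)
open Literature.Computability.QuantumComplexity.Simon (twist_eq_one_or)

/-- **Structure of the level-6 partner of a configuration-(c) side** (12 bits, `29/32 ≤ Φ < 1`).  See the module docstring.  NOT summit
progress. [this work] -/
theorem cp_partner_structure (f g : (Fin (6 + 6) → Bool) → Bool) (hf : IsDegLeFun 3 f) (hg : IsDegLeFun 3 g)
    (u' : (Fin (6 + 6) → Bool) → ℤ) (hu' : ∀ x, W (fun y => signOf (g y)) x = (2 : ℝ) ^ 5 * (u' x : ℝ))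
    (hodd : ∃ x, Odd (u' x)) (hΦ : (29 / 32 : ℝ) ≤ forrelation f g) (hhi : forrelation f g < 1)
    (u'' : (Fin (6 + 6) → Bool) → ℤ) (hu'' : ∀ y, W (fun x => signOf (f x)) y = (2 : ℝ) ^ 6 * (u'' y : ℝ)) :
    (∑ y, (u'' y - sZ (g y)) ^ 2 : ℤ) = 768 ∧
    #(univ.filter fun y : Fin (6 + 6) → Bool => ¬ Odd (u'' y)) = 512 ∧
    (∃ (V₀ : Finset (Fin (6 + 6) → Bool)) (z₀ : Fin (6 + 6) → Bool), zeroVec ∈ V₀ ∧ (∀ a ∈ V₀, ∀ b ∈ V₀, bxor a b ∈ V₀) ∧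
      #V₀ = 2 ^ 9 ∧ (univ.filter fun y : Fin (6 + 6) → Bool => ¬ Odd (u'' y)) = V₀.image (bxor z₀)) ∧
    (∃ Ω : (Fin (6 + 6) → Bool) → ℤ, (∀ y, Ω y = 0 ∨ Ω y = 4 ∨ Ω y = -4) ∧ #(univ.filter fun y => Ω y ≠ 0) = 16 ∧
      (∀ y, ¬ Odd (u'' y) → (u'' y - sZ (g y) + Ω y) ^ 2 = 1) ∧
      (∀ y, Odd (u'' y) → u'' y - sZ (g y) + Ω y = 0) ∧
      (∀ y, ∑ a, (if Odd (u' a) then (((u' a - 2 * sZ (f a)) : ℤ) : ℝ) else 0) * twist a y = -128 * (((u'' y - sZ (g y) + Ω y : ℤ)) : ℝ))) := by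
  classical
  have h2 := tw23_levelFive_ge2932_shape f g hf hg u' hu' hodd hΦ
  obtain ⟨V, xP, x', h0, hadd, hcardV, hS, hS', -, -, -, -, -, -⟩ := l5c_setup f g hg u' hu' hodd hΦ
  obtain ⟨-, hPe, hPs, hPO, hOsum, hsplit⟩ := bd_parseval f g hf hg u' hu' hodd hΦ h2
  set Z := (univ.filter fun y : Fin (6 + 6) → Bool => ¬ Odd (u'' y)) with hZdef
  have hmemZ : ∀ y, y ∈ Z ↔ ¬ Odd (u'' y) := fun y => by simp [hZdef]
  -- duality `ê = −128 e''`
  have huf : ∀ y, W (fun x => signOf (f x)) y = (2 : ℝ) ^ 5 * (((2 * u'' y : ℤ)) : ℝ) := fun y => by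
    rw [hu'' y]; push_cast; ring
  have hdual : ∀ y, ∑ a, (((u' a - 2 * sZ (f a)) : ℤ) : ℝ) * twist a y = -128 * (((u'' y - sZ (g y) : ℤ)) : ℝ) := by
    intro y; rw [l5k_duality f g u' hu' (fun y => 2 * u'' y) huf y]; push_cast; ring
  -- (a) `Σ e''² = 768`
  have ha : ∑ y, (((u'' y - sZ (g y) : ℤ)) : ℝ) ^ 2 = 768 := by
    have h1 : ∑ y, (∑ a, (((u' a - 2 * sZ (f a)) : ℤ) : ℝ) * twist a y) ^ 2 = 16384 * ∑ y, (((u'' y - sZ (g y) : ℤ)) : ℝ) ^ 2 := by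
      rw [mul_sum]; exact sum_congr rfl fun y _ => by rw [hdual y]; ring
    rw [h1] at hPe; linarith
  -- `Ω = Ô/128`
  set Ω : (Fin (6 + 6) → Bool) → ℤ := fun y =>
    if (∑ x ∈ ((univ.filter fun x : Fin (6 + 6) → Bool => ¬ Odd (u' x)).filter fun x => Odd ((u' x - 2 * sZ (f x)) / 2)), (((u' x - 2 * sZ (f x)) : ℤ) : ℝ) * twist x y) = 512 then 4 else if (∑ x ∈ ((univ.filter fun x : Fin (6 + 6) → Bool => ¬ Odd (u' x)).filter fun x => Odd ((u' x - 2 * sZ (f x)) / 2)), (((u' x - 2 * sZ (f x)) : ℤ) : ℝ) * twist x y) = -512 then -4 else 0 with hΩdef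
  have hΩval : ∀ y, Ω y = 0 ∨ Ω y = 4 ∨ Ω y = -4 := by
    intro y; simp only [Ω]; split_ifs <;> simp
  have hΩO : ∀ y, (∑ x ∈ ((univ.filter fun x : Fin (6 + 6) → Bool => ¬ Odd (u' x)).filter fun x => Odd ((u' x - 2 * sZ (f x)) / 2)), (((u' x - 2 * sZ (f x)) : ℤ) : ℝ) * twist x y) = 128 * (Ω y : ℝ) := by
    intro y
    rcases bd_Ohat f g hf hg u' hu' hodd hΦ h2 V xP x' h0 hadd hcardV hS hS' y with h | h | h <;> simp only [Ω] <;> rw [h] <;> norm_num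
  -- `ŝ = −128 (e'' + Ω)` and `Σ (e'' + Ω)² = 512`
  have hshat : ∀ y, ∑ a, (if Odd (u' a) then (((u' a - 2 * sZ (f a)) : ℤ) : ℝ) else 0) * twist a y = -128 * (((u'' y - sZ (g y) + Ω y : ℤ)) : ℝ) := by
    intro y
    have h := hsplit y
    rw [hdual y, hOsum y, hΩO y] at h
    push_cast at h ⊢
    linarith
  have h512 : ∑ y, (((u'' y - sZ (g y) + Ω y : ℤ)) : ℝ) ^ 2 = 512 := by
    have h1 : ∑ y, (∑ a, (if Odd (u' a) then (((u' a - 2 * sZ (f a)) : ℤ) : ℝ) else 0) * twist a y) ^ 2 =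
        16384 * ∑ y, (((u'' y - sZ (g y) + Ω y : ℤ)) : ℝ) ^ 2 := by
      rw [mul_sum]; exact sum_congr rfl fun y _ => by rw [hshat y]; ring
    rw [h1] at hPs; linarith
  have h512Z : (∑ y, (u'' y - sZ (g y) + Ω y) ^ 2 : ℤ) = 512 := by exact_mod_cast h512
  -- on `Z` the integer `e'' + Ω` is odd
  have hΩeven : ∀ y, Even (Ω y) := fun y => by
    rcases hΩval y with h | h | h <;> rw [h] <;> decide
  have hZodd : ∀ y, ¬ Odd (u'' y) → Odd (u'' y - sZ (g y) + Ω y) := by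
    intro y hy
    have hev := Int.even_iff.1 (Int.not_odd_iff_even.1 hy)
    rw [Int.odd_iff]
    rcases tp_sZ_cases (g y) with h | h <;> rcases hΩval y with h' | h' | h' <;> rw [h, h'] <;> omega
  have hZ1 : ∀ y, ¬ Odd (u'' y) → 1 ≤ (u'' y - sZ (g y) + Ω y) ^ 2 := by
    intro y hy
    have h0 := Int.odd_iff.1 (hZodd y hy)
    have : u'' y - sZ (g y) + Ω y ≤ -1 ∨ 1 ≤ u'' y - sZ (g y) + Ω y := by omega
    rcases this with h | h <;> nlinarith
  -- `#Z ≤ 512`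
  have hsplitZ : (∑ y, (u'' y - sZ (g y) + Ω y) ^ 2 : ℤ) =
      ∑ y ∈ Z, (u'' y - sZ (g y) + Ω y) ^ 2 + ∑ y ∈ univ.filter (fun y => y ∉ Z), (u'' y - sZ (g y) + Ω y) ^ 2 := by
    rw [← sum_filter_add_sum_filter_not univ (fun y => y ∈ Z)]
    congr 1
    exact sum_congr (by ext y; simp) fun _ _ => rfl
  have hZsum_ge : (#Z : ℤ) ≤ ∑ y ∈ Z, (u'' y - sZ (g y) + Ω y) ^ 2 := by
    have h1 : ∑ y ∈ Z, (1 : ℤ) ≤ ∑ y ∈ Z, (u'' y - sZ (g y) + Ω y) ^ 2 := sum_le_sum fun y hy => hZ1 y ((hmemZ y).1 hy)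
    rwa [sum_const, nsmul_eq_mul, mul_one] at h1
  have hoff_ge : (0 : ℤ) ≤ ∑ y ∈ univ.filter (fun y => y ∉ Z), (u'' y - sZ (g y) + Ω y) ^ 2 :=
    sum_nonneg fun y _ => sq_nonneg _
  -- `Z ≠ ∅`: otherwise `f` is bent and `Φ ∈ {1} ∪ (−∞, 7/8]`
  have hex : ∃ y, ¬ Odd (u'' y) := by
    by_contra hall
    push Not at hall
    have hge : ∀ y, (2 : ℝ) ^ (6 + 6) ≤ W (fun x => signOf (f x)) y ^ 2 := by
      intro y
      rw [hu'' y, mul_pow]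
      have h1 : (1 : ℝ) ≤ (u'' y : ℝ) ^ 2 := by
        have h0 := Int.odd_iff.1 (hall y)
        have : u'' y ≤ -1 ∨ 1 ≤ u'' y := by omega
        have h2 : (1 : ℤ) ≤ u'' y ^ 2 := by rcases this with h | h <;> nlinarith
        exact_mod_cast h2
      calc (2 : ℝ) ^ (6 + 6) = ((2 : ℝ) ^ 6) ^ 2 * 1 := by norm_num
        _ ≤ ((2 : ℝ) ^ 6) ^ 2 * ((u'' y : ℝ)) ^ 2 := by gcongr
    have hpar : ∑ y, W (fun x => signOf (f x)) y ^ 2 = (2 : ℝ) ^ (6 + 6) * 2 ^ (6 + 6) := by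
      rw [sum_W_sq]
      have : ∑ x : Fin (6 + 6) → Bool, signOf (f x) ^ 2 = 2 ^ (6 + 6) := by
        simp_rw [signOf_sq]; rw [sum_const, card_univ, Fintype.card_fun, Fintype.card_bool, Fintype.card_fin]; norm_num
      rw [this]
    have hbent : ∀ y, W (fun x => signOf (f x)) y ^ 2 = (2 : ℝ) ^ (6 + 6) := by
      have hsum : ∑ y : Fin (6 + 6) → Bool, (2 : ℝ) ^ (6 + 6) = ∑ y, W (fun x => signOf (f x)) y ^ 2 := by
        rw [hpar, sum_const, card_univ, Fintype.card_fun, Fintype.card_bool, Fintype.card_fin]; norm_num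
      have h := (sum_eq_sum_iff_of_le (fun y _ => hge y)).1 hsum
      exact fun y => (h y (mem_univ _)).symm
    have hΦ' : forrelation g f = forrelation f g := by
      rw [Summit.QuantumAdvantage.QuantumAdvantage.Theorems.SignedCubicForrelationNotPrBPP.Negative.HalfQuad.forrelation_comm]
    rcases tw_bent_end (m := 6) (by norm_num) g f hg hf hbent with h | h
    · rw [hΦ'] at h; rw [h] at hhi; exact lt_irrefl _ hhi
    · rw [hΦ'] at h; norm_num at h; linarith
  obtain ⟨y₁, hy₁⟩ := hex
  -- the parity of `u''` is cubic: `#Z ≥ 512`, so `#Z = 512` and `Z` is a 9-flat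
  have hp : IsDegLeFun 3 (fun y => decide (Odd (u'' y))) :=
    stub_walshTower stub_axParity (6 + 6) 6 3 f u'' hf hu'' (by intro k hk hkn; omega)
  have hp' : IsDegLeFun (2 + 1) (fun y => decide (Odd (u'' y)) ^^ true) := tb_isDegLeFun_xor_const hp true
  have hfilt : (univ.filter fun y : Fin (6 + 6) → Bool => (decide (Odd (u'' y)) ^^ true) = true) = Z :=
    filter_congr fun y _ => by simp
  have hne : ∃ y, (decide (Odd (u'' y)) ^^ true) = true := ⟨y₁, by simpa using hy₁⟩
  have hRM := bb_rmWeight_holds (6 + 6) 3 (fun y => decide (Odd (u'' y)) ^^ true) hp' hne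
  rw [hfilt] at hRM
  have hZcard : #Z = 512 := by norm_num at hRM; omega
  have hmw := mw_flat_of_minweight 2 (fun y => decide (Odd (u'' y)) ^^ true) hp' (by rw [hfilt, hZcard]; norm_num)
  rw [hfilt] at hmw
  obtain ⟨hV0, hVadd, hVcard, hcoset⟩ := hmw
  -- tightness: `(e'' + Ω)² = 1` on `Z`, `e'' + Ω = 0` off `Z`
  have hZsum : ∑ y ∈ Z, (u'' y - sZ (g y) + Ω y) ^ 2 = 512 ∧
      ∑ y ∈ univ.filter (fun y => y ∉ Z), (u'' y - sZ (g y) + Ω y) ^ 2 = 0 := by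
    rw [hZcard] at hZsum_ge; push_cast at hZsum_ge
    constructor <;> linarith [h512Z, hsplitZ]
  have honZ : ∀ y, ¬ Odd (u'' y) → (u'' y - sZ (g y) + Ω y) ^ 2 = 1 := by
    have hsum1 : ∑ y ∈ Z, (1 : ℤ) = ∑ y ∈ Z, (u'' y - sZ (g y) + Ω y) ^ 2 := by
      rw [hZsum.1, sum_const, nsmul_eq_mul, mul_one, hZcard]; norm_num
    have h := (sum_eq_sum_iff_of_le (fun y hy => hZ1 y ((hmemZ y).1 hy))).1 hsum1
    exact fun y hy => (h y ((hmemZ y).2 hy)).symm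
  have hoffZ : ∀ y, Odd (u'' y) → u'' y - sZ (g y) + Ω y = 0 := by
    intro y hy
    have hy' : y ∈ univ.filter (fun y => y ∉ Z) := by simp [hmemZ, hy]
    have h := (sum_eq_zero_iff_of_nonneg (fun y _ => sq_nonneg _)).1 hZsum.2 y hy'
    exact (pow_eq_zero_iff two_ne_zero).1 h
  -- `#C = 16`
  have hC : #(univ.filter fun y => Ω y ≠ 0) = 16 := by
    have h1 : ∀ y, (∑ a, (if a ∈ ((univ.filter fun x : Fin (6 + 6) → Bool => ¬ Odd (u' x)).filter fun x => Odd ((u' x - 2 * sZ (f x)) / 2)) then (((u' a - 2 * sZ (f a)) : ℤ) : ℝ) else 0) * twist a y) ^ 2 =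
        if Ω y ≠ 0 then (262144 : ℝ) else 0 := by
      intro y; rw [hOsum y, hΩO y]
      rcases hΩval y with h | h | h <;> rw [h] <;> norm_num
    rw [sum_congr rfl (fun y _ => h1 y), ← sum_filter, sum_const, nsmul_eq_mul] at hPO
    have : (#(univ.filter fun y => Ω y ≠ 0) : ℝ) = 16 := by linarith
    exact_mod_cast this
  refine ⟨by exact_mod_cast ha, hZcard, ⟨_, y₁, hV0, hVadd, by rw [hVcard, hZcard]; norm_num, hcoset y₁ (by simpa using hy₁)⟩,
    ⟨Ω, hΩval, hC, honZ, hoffZ, hshat⟩⟩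

end Summit.QuantumAdvantage.QuantumAdvantage.Theorems.CubicForrelation.NearExactIsExact

end
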